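import Summits.AnomalousDissipation.AnomalousDissipation.Theorems.UniformResolution.Negative.Agmon

/-!
# Negative knowledge for the crux `MomentParity.UniformResolution` (stmt-AnomalousDissipation-14330), VI:
# Galerkin steady states — band tests, the energy row and the enstrophy row

Certified infrastructure from the cdisprove work files of refuter-cdisprove-stmt-AnomalousDissipation-14330-0
(cycle 1). Supports stmt-AnomalousDissipation-14330; no route-item statement is asserted. Continued in
`Negative/SteadyResolved.lean` (the N-uniform `H²` bound and the resolution of steady Dirac masses).

* `IsGalerkinSteady ν f N u` — every level-`N` band test annihilates the generator row `⟨F(u), w⟩`.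
* `coef u`, `trunc N u = P_N u` (a real trigonometric polynomial on the ball), `lapCoef`, `lapTrunc N u = −ΔP_N u`;
  `isBandTest_trunc`, `isBandTest_lapTrunc` (both are level-`N` band tests for `u ∈ H`), `laplacian_trunc`,
  `coe_ae_eq_trunc`, `integral_norm_sq_trunc`, `integral_sum_norm_sq_partialDeriv_trunc`, `toReal_eGradNormSq_trunc`,
  `integral_norm_sq_lapTrunc`.
* `nsGeneratorPairing_trunc_eq`, `nsGeneratorPairing_lapTrunc_eq`: the energy-test and enstrophy-test rows of
  ANY level-`N` state (`⟨F(u), ū⟩ = ∫⟪f,ū⟫ − νG`, `⟨F(u), z⟩ = ∫⟪f,z⟫ − ∫⟪(ū·∇)ū,z⟫ − ν∫‖z‖²`, `z = −Δū`);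
  at a Galerkin steady state: ROW A `rowA_eq` (`νG = ∫⟪f, ū⟫`), ROW B `rowB_eq` (`ν∫‖z‖² = ∫⟪f,z⟫ − ∫⟪(ū·∇)ū,z⟫`).
* `abs_integral_inner_le_weighted` (Young with a weight), `norm_trunc_le` (Agmon for `ū`).
-/

namespace Summit.AnomalousDissipation.AnomalousDissipation.Theorems.UniformResolution.Negative

open MeasureTheory Filter Topology
open scoped ENNReal InnerProductSpace RealInnerProductSpace
open Literature.Analysis.FunctionSpaces Literature.Analysis.FluidPDE
open Summit.AnomalousDissipation.AnomalousDissipation.Theorems.QuarticGate.Negative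
open Summit.AnomalousDissipation.AnomalousDissipation.Theorems

noncomputable section

/-- Local notation for the real Hilbert space `L²(T³; ℝ³)`. -/
local notation "L2T3" => Lp (EuclideanSpace ℝ (Fin 3)) 2 (volume : Measure (UnitAddTorus (Fin 3)))

/-! ## 4. Galerkin steady states: the truncation and its Laplacian are band tests; the two rows -/

section Steady

open Summit.AnomalousDissipation.AnomalousDissipation.Theorems.QuarticGate.Negative


/-- `u ∈ H` is a GALERKIN STEADY STATE at level `N` for `(ν, f)`: every level-`N` band test annihilates
the generator row `⟨F(u), w⟩` (for a level-`N` field: `P_N P_σ F(u) = 0`). -/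
def IsGalerkinSteady (ν : ℝ) (f : UnitAddTorus (Fin 3) → EuclideanSpace ℝ (Fin 3)) (N : ℕ)
    (u : Torus.energySpace (Fin 3)) : Prop :=
  ∀ w : UnitAddTorus (Fin 3) → EuclideanSpace ℝ (Fin 3), IsBandTest N w → Torus.nsGeneratorPairing ν f u w = 0

/-- The Fourier coefficient family of (the representative of) `u ∈ H`. -/
def coef (u : Torus.energySpace (Fin 3)) : (Fin 3 → ℤ) → EuclideanSpace ℂ (Fin 3) :=
  fun k => UnitAddTorus.mFourierCoeff (EuclideanSpace.complexify ∘
    ((u.1 : L2T3) : UnitAddTorus (Fin 3) → EuclideanSpace ℝ (Fin 3))) k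

/-- The truncation `ū = P_N u` of the representative (a real trigonometric polynomial on the ball). -/
def trunc (N : ℕ) (u : Torus.energySpace (Fin 3)) : UnitAddTorus (Fin 3) → EuclideanSpace ℝ (Fin 3) :=
  Torus.fourierTruncate N ((u.1 : L2T3) : UnitAddTorus (Fin 3) → EuclideanSpace ℝ (Fin 3))

/-- The coefficient family of `−Δū`: `4π²|k|² û(k)`. -/
def lapCoef (u : Torus.energySpace (Fin 3)) : (Fin 3 → ℤ) → EuclideanSpace ℂ (Fin 3) :=
  fun k => (((4 * Real.pi ^ 2 * Torus.freqNormSq k : ℝ)) : ℂ) • coef u k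

/-- The field `z = −Δū`. -/
def lapTrunc (N : ℕ) (u : Torus.energySpace (Fin 3)) : UnitAddTorus (Fin 3) → EuclideanSpace ℝ (Fin 3) :=
  Torus.realTrigPoly (Torus.freqBall N) (lapCoef u)

variable {N : ℕ} (u : Torus.energySpace (Fin 3))

/-- `trunc_eq` (bookkeeping). [folklore] -/
theorem trunc_eq : trunc N u = Torus.realTrigPoly (Torus.freqBall N) (coef u) := rfl

/-- `integrable_coe` (bookkeeping). [folklore] -/
theorem integrable_coe : Integrable ((u.1 : L2T3) : UnitAddTorus (Fin 3) → EuclideanSpace ℝ (Fin 3)) volume :=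
  (Lp.memLp (u.1 : L2T3)).integrable one_le_two

/-- `isConjSymm_coef` (bookkeeping). [folklore] -/
theorem isConjSymm_coef : Torus.IsConjSymm (coef u) :=
  Torus.isConjSymm_mFourierCoeff (integrable_coe u)

/-- `coef_zero` (bookkeeping). [folklore] -/
theorem coef_zero : coef u 0 = 0 :=
  Torus.mFourierCoeff_complexify_coe_zero_of_mem u.2

/-- `isTransversal_coef` (bookkeeping). [folklore] -/
theorem isTransversal_coef (S : Finset (Fin 3 → ℤ)) : Torus.IsTransversal S (coef u) :=
  (Torus.isWeaklyDivFree_of_mem_energySpace u.2).isTransversal_mFourierCoeff (Lp.memLp _) S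

/-- `isConjSymm_lapCoef` (bookkeeping). [folklore] -/
theorem isConjSymm_lapCoef : Torus.IsConjSymm (lapCoef u) := by
  intro k
  simp only [lapCoef]
  rw [EuclideanSpace.conjVec_smul, Complex.conj_ofReal, isConjSymm_coef u k, Torus.freqNormSq_neg]

/-- `lapCoef_zero` (bookkeeping). [folklore] -/
theorem lapCoef_zero : lapCoef u 0 = 0 := by
  simp [lapCoef, coef_zero]

/-- `isTransversal_lapCoef` (bookkeeping). [folklore] -/
theorem isTransversal_lapCoef (S : Finset (Fin 3 → ℤ)) : Torus.IsTransversal S (lapCoef u) := by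
  intro k hk
  have h := isTransversal_coef u S k hk
  simp only [lapCoef, PiLp.smul_apply, smul_eq_mul]
  calc ∑ j, (k j : ℂ) * ((((4 * Real.pi ^ 2 * Torus.freqNormSq k : ℝ)) : ℂ) * coef u k j)
      = (((4 * Real.pi ^ 2 * Torus.freqNormSq k : ℝ)) : ℂ) * ∑ j, (k j : ℂ) * coef u k j := by
        rw [Finset.mul_sum]
        exact Finset.sum_congr rfl fun j _ => by ring
    _ = 0 := by rw [h, mul_zero]

/-- A real trigonometric polynomial whose zero coefficient vanishes has zero mean. [folklore] -/
theorem hasZeroMean_realTrigPoly_of_coeff_zero (S : Finset (Fin 3 → ℤ))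
    {c : (Fin 3 → ℤ) → EuclideanSpace ℂ (Fin 3)} (hc0 : c 0 = 0) :
    Torus.HasZeroMean (Torus.realTrigPoly S c) := by
  unfold Torus.HasZeroMean
  simp_rw [Torus.realTrigPoly_apply_eq_sum]
  rw [integral_finsetSum _ fun k _ => ?_]
  · refine Finset.sum_eq_zero fun k _ => ?_
    have hi : Integrable (fun x : UnitAddTorus (Fin 3) => UnitAddTorus.mFourier k x • c k) volume :=
      ((UnitAddTorus.mFourier k).continuous.smul continuous_const).integrable_unitAddTorus
    rw [ContinuousLinearMap.integral_comp_comm _ hi, integral_smul_const, Torus.integral_mFourier]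
    by_cases hk : k = 0
    · subst hk; simp [hc0]
    · rw [if_neg hk, zero_smul, map_zero]
  · exact (EuclideanSpace.realPart.continuous.comp
      ((UnitAddTorus.mFourier k).continuous.smul continuous_const)).integrable_unitAddTorus

/-- The truncation of a field of `H` is a level-`N` band test. [folklore] -/
theorem isBandTest_trunc : IsBandTest N (trunc N u) := by
  refine ⟨Torus.isSmooth_fourierTruncate _ _, ?_, ?_, fun k hk => ?_⟩
  · exact Torus.isDivFree_fourierTruncate (Lp.memLp _) (Torus.isWeaklyDivFree_of_mem_energySpace u.2) N
  · exact hasZeroMean_realTrigPoly_of_coeff_zero _ (coef_zero u)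
  · change UnitAddTorus.mFourierCoeff (EuclideanSpace.complexify ∘ Torus.fourierTruncate N _) k = 0
    rw [Torus.mFourierCoeff_fourierTruncate (integrable_coe u)]
    by_cases hkb : k ∈ Torus.freqBall N
    · have hk0 : k = 0 := by
        by_contra h
        exact hk (Finset.mem_erase.2 ⟨h, hkb⟩)
      rw [if_pos hkb, hk0]
      exact coef_zero u
    · rw [if_neg hkb]

/-- `z = −Δū` is a level-`N` band test. [folklore] -/
theorem isBandTest_lapTrunc : IsBandTest N (lapTrunc N u) := by
  refine ⟨Torus.isSmooth_realTrigPoly _ _, Torus.isDivFree_realTrigPoly (isTransversal_lapCoef u _),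
    hasZeroMean_realTrigPoly_of_coeff_zero _ (lapCoef_zero u), fun k hk => ?_⟩
  change UnitAddTorus.mFourierCoeff (EuclideanSpace.complexify ∘ Torus.realTrigPoly _ _) k = 0
  rw [Torus.mFourierCoeff_realTrigPoly Torus.neg_mem_freqBall_of_mem (isConjSymm_lapCoef u)]
  by_cases hkb : k ∈ Torus.freqBall N
  · have hk0 : k = 0 := by
      by_contra h
      exact hk (Finset.mem_erase.2 ⟨h, hkb⟩)
    rw [if_pos hkb, hk0]
    exact lapCoef_zero u
  · rw [if_neg hkb]

/-- `Δū = −z` pointwise. [folklore] -/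
theorem laplacian_trunc (x : UnitAddTorus (Fin 3)) : Torus.laplacian (trunc N u) x = -lapTrunc N u x := by
  rw [trunc_eq, Torus.laplacian_realTrigPoly, lapTrunc,
    show (fun k => -((((4 * Real.pi ^ 2 * Torus.freqNormSq k : ℝ)) : ℂ) • coef u k)) =
      (0 : (Fin 3 → ℤ) → EuclideanSpace ℂ (Fin 3)) - lapCoef u from by funext k; simp [lapCoef],
    Torus.realTrigPoly_sub, Torus.realTrigPoly_zero]
  simp

/-- `coe_ae_eq_trunc` (bookkeeping). [folklore] -/
theorem coe_ae_eq_trunc (hu : IsLevel N u) :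
    ((u.1 : L2T3) : UnitAddTorus (Fin 3) → EuclideanSpace ℝ (Fin 3)) =ᵐ[volume] trunc N u :=
  (CubicParityLoud.Negative.fourierTruncate_ae_eq_of_isLevel (N := N) (u := u) hu).symm

/-- `∫ ‖ū‖² = ‖u‖²`. [folklore] -/
theorem integral_norm_sq_trunc (hu : IsLevel N u) : ∫ x, ‖trunc N u x‖ ^ 2 = ‖u‖ ^ 2 := by
  have h : ‖u‖ = ‖(u.1 : L2T3)‖ := rfl
  rw [h, ← Torus.integral_norm_sq_coe_eq]
  exact integral_congr_ae ((coe_ae_eq_trunc u hu).mono fun x hx => by simp [hx])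

/-- `∫ Σⱼ‖∂ⱼū‖² = G := 4π² Σ |k|²‖û k‖²`. [folklore] -/
theorem integral_sum_norm_sq_partialDeriv_trunc :
    ∫ x, ∑ j, ‖Torus.partialDeriv j (trunc N u) x‖ ^ 2 =
      4 * Real.pi ^ 2 * ∑ k ∈ Torus.freqBall N, Torus.freqNormSq k * ‖coef u k‖ ^ 2 :=
  integral_sum_norm_sq_partialDeriv_realTrigPoly Torus.neg_mem_freqBall_of_mem (isConjSymm_coef u)

/-- `(eGradNormSq ū).toReal = G`. [folklore] -/
theorem toReal_eGradNormSq_trunc :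
    (Torus.eGradNormSq (trunc N u)).toReal =
      4 * Real.pi ^ 2 * ∑ k ∈ Torus.freqBall N, Torus.freqNormSq k * ‖coef u k‖ ^ 2 :=
  Torus.toReal_eGradNormSq_realTrigPoly Torus.neg_mem_freqBall_of_mem (isConjSymm_coef u)

/-- `∫ ‖z‖² = D² := 16π⁴ Σ |k|⁴‖û k‖²`. [folklore] -/
theorem integral_norm_sq_lapTrunc :
    ∫ x, ‖lapTrunc N u x‖ ^ 2 = 16 * Real.pi ^ 4 * ∑ k ∈ Torus.freqBall N, Torus.freqNormSq k ^ 2 * ‖coef u k‖ ^ 2 := by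
  rw [← integral_norm_sq_laplacian_realTrigPoly Torus.neg_mem_freqBall_of_mem (isConjSymm_coef u)]
  refine integral_congr_ae (ae_of_all _ fun x => ?_)
  change ‖lapTrunc N u x‖ ^ 2 = ‖Torus.laplacian (trunc N u) x‖ ^ 2
  rw [laplacian_trunc, norm_neg]


/-! ### The two rows -/

variable {u} {ν : ℝ} {f : UnitAddTorus (Fin 3) → EuclideanSpace ℝ (Fin 3)}

/-- **The energy-test row of ANY level-`N` state**: `⟨F(u), ū⟩ = ∫⟪f, ū⟫ − ν G`, `G = 4π² Σ|k|²‖û k‖²`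
(generator = flux on the representative; the transport term `∫⟪ū,(ū·∇)ū⟫` vanishes). [folklore] -/
theorem nsGeneratorPairing_trunc_eq (ν : ℝ) (hf : Torus.IsSmooth f) (hu : IsLevel N u) :
    Torus.nsGeneratorPairing ν f u (trunc N u) =
      (∫ x, ⟪f x, trunc N u x⟫_ℝ) - ν * (4 * Real.pi ^ 2 * ∑ k ∈ Torus.freqBall N, Torus.freqNormSq k * ‖coef u k‖ ^ 2) := by
  have hS := Torus.isSmooth_fourierTruncate N ((u.1 : L2T3) : UnitAddTorus (Fin 3) → EuclideanSpace ℝ (Fin 3))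
  change Torus.IsSmooth (trunc N u) at hS
  have hdiv : Torus.IsDivFree (trunc N u) := (isBandTest_trunc u).2.1
  rw [Torus.nsGeneratorPairing_eq_flux ν (hf.memLp 2) hS (coe_ae_eq_trunc u hu)]
  have hi1 : Integrable (fun x => ⟪trunc N u x, Torus.convect (trunc N u) (trunc N u) x⟫_ℝ) volume :=
    (hS.continuous.inner (hS.convect hS).continuous).integrable_unitAddTorus
  have hi2 : Integrable (fun x => ν * ⟪trunc N u x, Torus.laplacian (trunc N u) x⟫_ℝ) volume :=
    ((hS.continuous.inner hS.laplacian.continuous).integrable_unitAddTorus).const_mul ν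
  have hi3 : Integrable (fun x => ⟪f x, trunc N u x⟫_ℝ) volume :=
    (hf.continuous.inner hS.continuous).integrable_unitAddTorus
  have hi12 : Integrable (fun x => ⟪trunc N u x, Torus.convect (trunc N u) (trunc N u) x⟫_ℝ +
      ν * ⟪trunc N u x, Torus.laplacian (trunc N u) x⟫_ℝ) volume := hi1.add hi2
  rw [integral_add hi12 hi3, integral_add hi1 hi2, integral_const_mul]
  -- the transport term vanishes
  have h1 : ∫ x, ⟪trunc N u x, Torus.convect (trunc N u) (trunc N u) x⟫_ℝ = 0 := by
    have h := Torus.integral_inner_convect_add_eq_zero hS hdiv hS hS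
    have hsym : ∫ x, ⟪Torus.convect (trunc N u) (trunc N u) x, trunc N u x⟫_ℝ =
        ∫ x, ⟪trunc N u x, Torus.convect (trunc N u) (trunc N u) x⟫_ℝ :=
      integral_congr_ae (ae_of_all _ fun x => real_inner_comm _ _)
    linarith
  -- the Stokes term
  have h2 : ∫ x, ⟪trunc N u x, Torus.laplacian (trunc N u) x⟫_ℝ =
      -(4 * Real.pi ^ 2 * ∑ k ∈ Torus.freqBall N, Torus.freqNormSq k * ‖coef u k‖ ^ 2) := by
    rw [← toReal_eGradNormSq_trunc u, trunc,
      ← Torus.integral_inner_laplacian_fourierTruncate (integrable_coe u) N]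
    exact integral_congr_ae ((coe_ae_eq_trunc u hu).mono fun x hx => by
      change ⟪Torus.fourierTruncate N _ x, _⟫_ℝ = ⟪_, _⟫_ℝ
      rw [hx]
      rfl)
  rw [h1, h2]
  ring

/-- **ROW A (energy row at a Galerkin steady state)**: `ν G = ∫⟪f, ū⟫`, `G = 4π² Σ|k|²‖û k‖²`. [folklore] -/
theorem rowA_eq (hf : Torus.IsSmooth f) (hu : IsLevel N u) (hst : IsGalerkinSteady ν f N u) :
    ν * (4 * Real.pi ^ 2 * ∑ k ∈ Torus.freqBall N, Torus.freqNormSq k * ‖coef u k‖ ^ 2) =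
      ∫ x, ⟪f x, trunc N u x⟫_ℝ := by
  have h0 := hst (trunc N u) (isBandTest_trunc u)
  rw [nsGeneratorPairing_trunc_eq ν hf hu] at h0
  linarith

/-- **The enstrophy-test row of ANY level-`N` state**: with `z = −Δū`,
`⟨F(u), z⟩ = ∫⟪f, z⟫ − ∫⟪(ū·∇)ū, z⟫ − ν ∫‖z‖²`. [folklore] -/
theorem nsGeneratorPairing_lapTrunc_eq (ν : ℝ) (hf : Torus.IsSmooth f) (hu : IsLevel N u) :
    Torus.nsGeneratorPairing ν f u (lapTrunc N u) =
      (∫ x, ⟪f x, lapTrunc N u x⟫_ℝ) - (∫ x, ⟪Torus.convect (trunc N u) (trunc N u) x, lapTrunc N u x⟫_ℝ) -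
        ν * ∫ x, ‖lapTrunc N u x‖ ^ 2 := by
  have hS := Torus.isSmooth_fourierTruncate N ((u.1 : L2T3) : UnitAddTorus (Fin 3) → EuclideanSpace ℝ (Fin 3))
  change Torus.IsSmooth (trunc N u) at hS
  have hZ : Torus.IsSmooth (lapTrunc N u) := Torus.isSmooth_realTrigPoly _ _
  have hdiv : Torus.IsDivFree (trunc N u) := (isBandTest_trunc u).2.1
  rw [Torus.nsGeneratorPairing_eq_flux ν (hf.memLp 2) hZ (coe_ae_eq_trunc u hu)]
  have hi1 : Integrable (fun x => ⟪trunc N u x, Torus.convect (trunc N u) (lapTrunc N u) x⟫_ℝ) volume :=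
    (hS.continuous.inner (hS.convect hZ).continuous).integrable_unitAddTorus
  have hi2 : Integrable (fun x => ν * ⟪trunc N u x, Torus.laplacian (lapTrunc N u) x⟫_ℝ) volume :=
    ((hS.continuous.inner hZ.laplacian.continuous).integrable_unitAddTorus).const_mul ν
  have hi3 : Integrable (fun x => ⟪f x, lapTrunc N u x⟫_ℝ) volume :=
    (hf.continuous.inner hZ.continuous).integrable_unitAddTorus
  have hi12 : Integrable (fun x => ⟪trunc N u x, Torus.convect (trunc N u) (lapTrunc N u) x⟫_ℝ +
      ν * ⟪trunc N u x, Torus.laplacian (lapTrunc N u) x⟫_ℝ) volume := hi1.add hi2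
  rw [integral_add hi12 hi3, integral_add hi1 hi2, integral_const_mul]
  -- the transport term
  have h1 : ∫ x, ⟪trunc N u x, Torus.convect (trunc N u) (lapTrunc N u) x⟫_ℝ =
      -∫ x, ⟪Torus.convect (trunc N u) (trunc N u) x, lapTrunc N u x⟫_ℝ := by
    have h := Torus.integral_inner_convect_eq_neg hS hdiv hS hZ
    linarith
  -- the Stokes term
  have h2 : ∫ x, ⟪trunc N u x, Torus.laplacian (lapTrunc N u) x⟫_ℝ = -∫ x, ‖lapTrunc N u x‖ ^ 2 := by
    rw [← Torus.integral_inner_laplacian_comm hS hZ, ← integral_neg]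
    refine integral_congr_ae (ae_of_all _ fun x => ?_)
    change ⟪Torus.laplacian (trunc N u) x, lapTrunc N u x⟫_ℝ = -‖lapTrunc N u x‖ ^ 2
    rw [laplacian_trunc, inner_neg_left, real_inner_self_eq_norm_sq]
  rw [h1, h2]
  ring

/-- **ROW B (enstrophy-type row at a Galerkin steady state)**: with `z = −Δū`,
`ν ∫‖z‖² = ∫⟪f, z⟫ − ∫⟪(ū·∇)ū, z⟫`. [folklore] -/
theorem rowB_eq (hf : Torus.IsSmooth f) (hu : IsLevel N u) (hst : IsGalerkinSteady ν f N u) :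
    ν * ∫ x, ‖lapTrunc N u x‖ ^ 2 =
      (∫ x, ⟪f x, lapTrunc N u x⟫_ℝ) - ∫ x, ⟪Torus.convect (trunc N u) (trunc N u) x, lapTrunc N u x⟫_ℝ := by
  have h0 := hst (lapTrunc N u) (isBandTest_lapTrunc u)
  rw [nsGeneratorPairing_lapTrunc_eq ν hf hu] at h0
  linarith

/-- Weighted Cauchy–Schwarz / Young: `|∫⟪g, h⟫| ≤ ½ (a ∫‖g‖² + a⁻¹ ∫‖h‖²)` for `a > 0`. [folklore] -/
theorem abs_integral_inner_le_weighted {g w : UnitAddTorus (Fin 3) → EuclideanSpace ℝ (Fin 3)}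
    (hg : MemLp g 2 volume) (hw : MemLp w 2 volume) {a : ℝ} (ha : 0 < a) :
    |∫ x, ⟪g x, w x⟫_ℝ| ≤ 2⁻¹ * (a * (∫ x, ‖g x‖ ^ 2) + a⁻¹ * ∫ x, ‖w x‖ ^ 2) := by
  set b : ℝ := Real.sqrt a with hb
  have hb0 : 0 < b := Real.sqrt_pos.2 ha
  have hbb : b ^ 2 = a := Real.sq_sqrt ha.le
  have hineq := Torus.abs_integral_inner_le (hg.const_smul b) (hw.const_smul b⁻¹)
  have e1 : ∫ x, ⟪(b • g) x, (b⁻¹ • w) x⟫_ℝ = ∫ x, ⟪g x, w x⟫_ℝ := by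
    refine integral_congr_ae (ae_of_all _ fun x => ?_)
    simp only [Pi.smul_apply, inner_smul_left, inner_smul_right, RCLike.conj_to_real]
    rw [← mul_assoc, inv_mul_cancel₀ hb0.ne', one_mul]
  have e2 : ∫ x, ‖(b • g) x‖ ^ 2 = a * ∫ x, ‖g x‖ ^ 2 := by
    rw [← integral_const_mul]
    refine integral_congr_ae (ae_of_all _ fun x => ?_)
    simp only [Pi.smul_apply, norm_smul, Real.norm_eq_abs, mul_pow, sq_abs, hbb]
  have e3 : ∫ x, ‖(b⁻¹ • w) x‖ ^ 2 = a⁻¹ * ∫ x, ‖w x‖ ^ 2 := by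
    rw [← integral_const_mul]
    refine integral_congr_ae (ae_of_all _ fun x => ?_)
    simp only [Pi.smul_apply, norm_smul, Real.norm_eq_abs, mul_pow, sq_abs, inv_pow, hbb]
  rw [e1, e2, e3] at hineq
  exact hineq

/-- Agmon bound for `ū` with the zero mode removed (`û(0) = 0`). [folklore] -/
theorem norm_trunc_le (i₀ : ℕ) (x : UnitAddTorus (Fin 3)) :
    ‖trunc N u x‖ ≤
      Real.sqrt (384 * (4 : ℝ) ^ i₀) * Real.sqrt (∑ k ∈ Torus.freqBall N, Torus.freqNormSq k * ‖coef u k‖ ^ 2) +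
        Real.sqrt (128 * ((2 : ℝ)⁻¹) ^ i₀) *
          Real.sqrt (∑ k ∈ Torus.freqBall N, Torus.freqNormSq k ^ 2 * ‖coef u k‖ ^ 2) :=
  norm_realTrigPoly_le_agmon _ (coef_zero u) i₀ x

end Steady

end

end Summit.AnomalousDissipation.AnomalousDissipation.Theorems.UniformResolution.Negative
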